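import Summits.QuantumFields.YangMills.Theorems.BalabanLadderIRTwistedSlabAxialGauge
import HarnessLib

/-!
# Classification of the classical vacua of a twisted `Fin` box: gauge transforms of twist-eating ladders

HELPER toward stub **T1** `TwistedSlabAnchor` (LINE `twisted-slab-continuity`, crux `IRcof` stmt-QuantumFields-26930, census row 43;
LEAD prover ym-ir-line-tsc-p1 g2; `--supports` the crux, `--as helper`).  File 3/4 of next-seat-plan item (1) — THE CLASSIFICATION.

For ANY group `G`, any box `(m₀+1) × (m₁+1) × (m₂+1) × (m₃+1)` and any CENTRE-valued 't Hooft tensor `w`: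
* `gaugeAct_axialGauge_shift_eq`, `gaugeAct_axialGauge_line_const`, `gaugeAct_axialGauge_sheet` — in the sheet-adapted axial gauge of a
  twisted-flat `U` (file 2: all non-sheet links trivial) the `μ`-links on the sheet `x_μ = 0` all carry the SAME element `Γ_μ`
  (a `(ν, μ)`-plaquette off the `ν`-stack is trivial and its two `ν`-links are gauged away, so the sheet value is constant along `ν`);
* ★ `gaugeAct_axialGauge_eq_ladderConfig` — so the gauged configuration IS the ladder `ladderConfig Γ`;
* ★★ `exists_gaugeAct_ladderConfig_of_twistedFlat`, `twistedFlat_iff_exists_gaugeAct_ladderConfig` — **a configuration is twisted-flat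
  (zero twisted Wilson action for a faithful unitary `ρ`) iff it is a gauge transform of a ladder whose quadruple EATS the twist**,
  `w μ ν · Γ_μ Γ_ν Γ_μ⁻¹ Γ_ν⁻¹ = 1` (`μ < ν`) — the anisotropic `Fin`-box counterpart of
  `Literature…TwistedSector.isTwistedFlat_iff_exists_gaugeTransform_eaterConfig` ('t Hooft 1979 §3; van Baal 1982; González-Arroyo 1998
  §4.2 «flat connections on the twisted torus ↔ twist-eating transition functions»);
* `exists_twistedFlat_iff_exists_eater` — a twist sector has a classical vacuum iff SOME quadruple eats its tensor (for the orthogonally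
  twisted slab there is none: `no_twistedFlat_slab`; for the magnetically twisted slab the eaters are `(Γ₀, Γ₁; c₂, c₃)` with central
  `c₂, c₃`: `twistedFlat_holonomies_central`, `ladder_central_twistedFlat`).
File 4 (`…TwistedSlabVacuumOrbits`): gauge classes ↔ quadruples modulo simultaneous conjugation, stabilisers, and the `SU(N)` reading
(`N²` orbits `≅ 𝒢/Z_N` for a generating twist) — the critical manifold of the e₂-projected slab weight from which any `β → ∞`
(Laplace–Morse–Bott ∕ semiclassical transfer-operator) analysis of T1 starts.

HONEST FRAMING: lattice group algebra on one box; no estimate; nothing here bears on `IRcof`, `IR`, or the Yang–Mills mass gap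
(Clay: NOT proved); R4 = `BalabanLadder.UV` only.  References: 't Hooft, Nucl. Phys. B153 (1979) §3; van Baal, Commun. Math. Phys. 85
(1982) 529; González-Arroyo, hep-th/9807108 §4.2, §8.1; García Pérez–González-Arroyo–Okawa, IJMPA 29 (2014) §2; Creutz, Phys. Rev.
D15 (1977) 1128.
-/

set_option autoImplicit false

open Literature.MathematicalPhysics.QuantumFieldTheory

namespace Summit.QuantumFields.YangMills.Cruxes.IRcof.TwistedSlab

variable {G : Type*} [Group G]

/-! ## §3 Sheet links are constant in the axial gauge; the configuration is a ladder -/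

/-- Values along a window `[1, M+1]` that are stable under each step are constant. [folklore] -/
theorem eq_of_forall_succ_eq {α : Type*} {f : ℕ → α} {M : ℕ} (h : ∀ t, 1 ≤ t → t ≤ M → f (t + 1) = f t) :
    ∀ t, 1 ≤ t → t ≤ M + 1 → f t = f 1 := by
  intro t ht1 ht
  induction t with
  | zero => omega
  | succ n ih =>
      rcases Nat.lt_or_ge n 1 with hn | hn
      · obtain rfl : n = 0 := by omega
        rfl
      · rw [h n hn (by omega), ih hn (by omega)]

section Classification

open Fin.NatCast

variable {m₀ m₁ m₂ m₃ : ℕ} {w : Fin 4 → Fin 4 → G}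
  {U : FinTorusSite (m₀ + 1) (m₁ + 1) (m₂ + 1) (m₃ + 1) × Fin 4 → G}

/-- In the axial gauge of a twisted-flat configuration, the value of a `μ`-link does not change under a shift in another direction `ν`
off the `ν`-sheet (the `(ν, μ)`-plaquette there is trivial and its two `ν`-links are gauged to `1`). [folklore] -/
theorem gaugeAct_axialGauge_shift_eq (hw : ∀ μ ν, w μ ν ∈ Subgroup.center G)
    (hflat : ∀ (x : FinTorusSite (m₀ + 1) (m₁ + 1) (m₂ + 1) (m₃ + 1)) (μ ν : Fin 4), μ < ν →
      tHooftTwistTensor w x μ ν * finTorusPlaquette U x μ ν = 1)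
    (x : FinTorusSite (m₀ + 1) (m₁ + 1) (m₂ + 1) (m₃ + 1)) {μ ν : Fin 4} (hμν : μ ≠ ν) (hν : finTorusSiteCoord x ν ≠ 0) :
    gaugeAct (axialGauge U) U (x.shift ν, μ) = gaugeAct (axialGauge U) U (x, μ) := by
  have hWflat := (twistedFlat_gaugeAct_iff hw (axialGauge U) U).mpr hflat
  have hP := (plaquette_eq_one_of_coord_ne_zero hWflat hμν.symm hν).1
  rw [finTorusPlaquette_eq_one_iff, gaugeAct_axialGauge_of_coord_ne_zero hflat x hν,
    gaugeAct_axialGauge_of_coord_ne_zero hflat (x.shift μ) (by rwa [finTorusSiteCoord_shift_of_ne x hμν.symm]),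
    one_mul, mul_one] at hP
  exact hP

/-- Constancy of the `μ`-links of the axial gauge along a lattice line in direction `ν ≠ μ` parametrised from the `ν`-coordinate `1`
(`e t` = the site with `ν`-coordinate `t`, `t ∈ [1, M+1]`, `M + 1` the side). [folklore] -/
theorem gaugeAct_axialGauge_line_const (hw : ∀ μ ν, w μ ν ∈ Subgroup.center G)
    (hflat : ∀ (x : FinTorusSite (m₀ + 1) (m₁ + 1) (m₂ + 1) (m₃ + 1)) (μ ν : Fin 4), μ < ν →
      tHooftTwistTensor w x μ ν * finTorusPlaquette U x μ ν = 1)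
    (e : ℕ → FinTorusSite (m₀ + 1) (m₁ + 1) (m₂ + 1) (m₃ + 1)) {μ ν : Fin 4} (hμν : μ ≠ ν)
    (he : ∀ t, (e t).shift ν = e (t + 1)) {M : ℕ} (hc : ∀ t, 1 ≤ t → t ≤ M → finTorusSiteCoord (e t) ν ≠ 0)
    {t : ℕ} (ht1 : 1 ≤ t) (ht : t ≤ M + 1) :
    gaugeAct (axialGauge U) U (e t, μ) = gaugeAct (axialGauge U) U (e 1, μ) :=
  eq_of_forall_succ_eq (f := fun t => gaugeAct (axialGauge U) U (e t, μ))
    (fun t h1 h2 => by rw [← he t]; exact gaugeAct_axialGauge_shift_eq hw hflat (e t) hμν (hc t h1 h2)) t ht1 ht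

/-- **The four sheets**: in the axial gauge every `μ`-link on the sheet `x_μ = 0` carries the SAME element `Γ_μ` (read at the base
site of the sheet, the other coordinates equal to `1`). [folklore] -/
theorem gaugeAct_axialGauge_sheet (hw : ∀ μ ν, w μ ν ∈ Subgroup.center G)
    (hflat : ∀ (x : FinTorusSite (m₀ + 1) (m₁ + 1) (m₂ + 1) (m₃ + 1)) (μ ν : Fin 4), μ < ν →
      tHooftTwistTensor w x μ ν * finTorusPlaquette U x μ ν = 1)
    {i j k l : ℕ} (hi1 : 1 ≤ i) (hi : i ≤ m₀ + 1) (hj1 : 1 ≤ j) (hj : j ≤ m₁ + 1) (hk1 : 1 ≤ k) (hk : k ≤ m₂ + 1)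
    (hl1 : 1 ≤ l) (hl : l ≤ m₃ + 1) :
    gaugeAct (axialGauge U) U (natSite m₀ m₁ m₂ m₃ 0 j k l, 0) = gaugeAct (axialGauge U) U (natSite m₀ m₁ m₂ m₃ 0 1 1 1, 0) ∧
    gaugeAct (axialGauge U) U (natSite m₀ m₁ m₂ m₃ i 0 k l, 1) = gaugeAct (axialGauge U) U (natSite m₀ m₁ m₂ m₃ 1 0 1 1, 1) ∧
    gaugeAct (axialGauge U) U (natSite m₀ m₁ m₂ m₃ i j 0 l, 2) = gaugeAct (axialGauge U) U (natSite m₀ m₁ m₂ m₃ 1 1 0 1, 2) ∧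
    gaugeAct (axialGauge U) U (natSite m₀ m₁ m₂ m₃ i j k 0, 3) = gaugeAct (axialGauge U) U (natSite m₀ m₁ m₂ m₃ 1 1 1 0, 3) := by
  have hc := fun i j k l => coord_natSite_ne_zero (m₀ := m₀) (m₁ := m₁) (m₂ := m₂) (m₃ := m₃) i j k l
  have hs := fun i j k l => natSite_shift (m₀ := m₀) (m₁ := m₁) (m₂ := m₂) (m₃ := m₃) i j k l
  refine ⟨?_, ?_, ?_, ?_⟩
  · have h1 : gaugeAct (axialGauge U) U (natSite m₀ m₁ m₂ m₃ 0 j k l, 0) = gaugeAct (axialGauge U) U (natSite m₀ m₁ m₂ m₃ 0 1 k l, 0) :=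
      gaugeAct_axialGauge_line_const hw hflat (fun t => natSite m₀ m₁ m₂ m₃ 0 t k l) (μ := 0) (ν := 1) (by decide)
        (fun t => (hs 0 t k l).2.1) (fun t h1 h2 => (hc 0 t k l).2.1 h1 h2) hj1 hj
    have h2 : gaugeAct (axialGauge U) U (natSite m₀ m₁ m₂ m₃ 0 1 k l, 0) = gaugeAct (axialGauge U) U (natSite m₀ m₁ m₂ m₃ 0 1 1 l, 0) :=
      gaugeAct_axialGauge_line_const hw hflat (fun t => natSite m₀ m₁ m₂ m₃ 0 1 t l) (μ := 0) (ν := 2) (by decide)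
        (fun t => (hs 0 1 t l).2.2.1) (fun t h1 h2 => (hc 0 1 t l).2.2.1 h1 h2) hk1 hk
    have h3 : gaugeAct (axialGauge U) U (natSite m₀ m₁ m₂ m₃ 0 1 1 l, 0) = gaugeAct (axialGauge U) U (natSite m₀ m₁ m₂ m₃ 0 1 1 1, 0) :=
      gaugeAct_axialGauge_line_const hw hflat (fun t => natSite m₀ m₁ m₂ m₃ 0 1 1 t) (μ := 0) (ν := 3) (by decide)
        (fun t => (hs 0 1 1 t).2.2.2) (fun t h1 h2 => (hc 0 1 1 t).2.2.2 h1 h2) hl1 hl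
    rw [h1, h2, h3]
  · have h1 : gaugeAct (axialGauge U) U (natSite m₀ m₁ m₂ m₃ i 0 k l, 1) = gaugeAct (axialGauge U) U (natSite m₀ m₁ m₂ m₃ 1 0 k l, 1) :=
      gaugeAct_axialGauge_line_const hw hflat (fun t => natSite m₀ m₁ m₂ m₃ t 0 k l) (μ := 1) (ν := 0) (by decide)
        (fun t => (hs t 0 k l).1) (fun t h1 h2 => (hc t 0 k l).1 h1 h2) hi1 hi
    have h2 : gaugeAct (axialGauge U) U (natSite m₀ m₁ m₂ m₃ 1 0 k l, 1) = gaugeAct (axialGauge U) U (natSite m₀ m₁ m₂ m₃ 1 0 1 l, 1) :=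
      gaugeAct_axialGauge_line_const hw hflat (fun t => natSite m₀ m₁ m₂ m₃ 1 0 t l) (μ := 1) (ν := 2) (by decide)
        (fun t => (hs 1 0 t l).2.2.1) (fun t h1 h2 => (hc 1 0 t l).2.2.1 h1 h2) hk1 hk
    have h3 : gaugeAct (axialGauge U) U (natSite m₀ m₁ m₂ m₃ 1 0 1 l, 1) = gaugeAct (axialGauge U) U (natSite m₀ m₁ m₂ m₃ 1 0 1 1, 1) :=
      gaugeAct_axialGauge_line_const hw hflat (fun t => natSite m₀ m₁ m₂ m₃ 1 0 1 t) (μ := 1) (ν := 3) (by decide)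
        (fun t => (hs 1 0 1 t).2.2.2) (fun t h1 h2 => (hc 1 0 1 t).2.2.2 h1 h2) hl1 hl
    rw [h1, h2, h3]
  · have h1 : gaugeAct (axialGauge U) U (natSite m₀ m₁ m₂ m₃ i j 0 l, 2) = gaugeAct (axialGauge U) U (natSite m₀ m₁ m₂ m₃ 1 j 0 l, 2) :=
      gaugeAct_axialGauge_line_const hw hflat (fun t => natSite m₀ m₁ m₂ m₃ t j 0 l) (μ := 2) (ν := 0) (by decide)
        (fun t => (hs t j 0 l).1) (fun t h1 h2 => (hc t j 0 l).1 h1 h2) hi1 hi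
    have h2 : gaugeAct (axialGauge U) U (natSite m₀ m₁ m₂ m₃ 1 j 0 l, 2) = gaugeAct (axialGauge U) U (natSite m₀ m₁ m₂ m₃ 1 1 0 l, 2) :=
      gaugeAct_axialGauge_line_const hw hflat (fun t => natSite m₀ m₁ m₂ m₃ 1 t 0 l) (μ := 2) (ν := 1) (by decide)
        (fun t => (hs 1 t 0 l).2.1) (fun t h1 h2 => (hc 1 t 0 l).2.1 h1 h2) hj1 hj
    have h3 : gaugeAct (axialGauge U) U (natSite m₀ m₁ m₂ m₃ 1 1 0 l, 2) = gaugeAct (axialGauge U) U (natSite m₀ m₁ m₂ m₃ 1 1 0 1, 2) :=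
      gaugeAct_axialGauge_line_const hw hflat (fun t => natSite m₀ m₁ m₂ m₃ 1 1 0 t) (μ := 2) (ν := 3) (by decide)
        (fun t => (hs 1 1 0 t).2.2.2) (fun t h1 h2 => (hc 1 1 0 t).2.2.2 h1 h2) hl1 hl
    rw [h1, h2, h3]
  · have h1 : gaugeAct (axialGauge U) U (natSite m₀ m₁ m₂ m₃ i j k 0, 3) = gaugeAct (axialGauge U) U (natSite m₀ m₁ m₂ m₃ 1 j k 0, 3) :=
      gaugeAct_axialGauge_line_const hw hflat (fun t => natSite m₀ m₁ m₂ m₃ t j k 0) (μ := 3) (ν := 0) (by decide)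
        (fun t => (hs t j k 0).1) (fun t h1 h2 => (hc t j k 0).1 h1 h2) hi1 hi
    have h2 : gaugeAct (axialGauge U) U (natSite m₀ m₁ m₂ m₃ 1 j k 0, 3) = gaugeAct (axialGauge U) U (natSite m₀ m₁ m₂ m₃ 1 1 k 0, 3) :=
      gaugeAct_axialGauge_line_const hw hflat (fun t => natSite m₀ m₁ m₂ m₃ 1 t k 0) (μ := 3) (ν := 1) (by decide)
        (fun t => (hs 1 t k 0).2.1) (fun t h1 h2 => (hc 1 t k 0).2.1 h1 h2) hj1 hj
    have h3 : gaugeAct (axialGauge U) U (natSite m₀ m₁ m₂ m₃ 1 1 k 0, 3) = gaugeAct (axialGauge U) U (natSite m₀ m₁ m₂ m₃ 1 1 1 0, 3) :=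
      gaugeAct_axialGauge_line_const hw hflat (fun t => natSite m₀ m₁ m₂ m₃ 1 1 t 0) (μ := 3) (ν := 2) (by decide)
        (fun t => (hs 1 1 t 0).2.2.1) (fun t h1 h2 => (hc 1 1 t 0).2.2.1 h1 h2) hk1 hk
    rw [h1, h2, h3]

/-- **The quadruple read off the axial gauge**: the sheet values at the base sites of the four sheets. [folklore] -/
theorem gaugeAct_axialGauge_eq_ladderConfig (hw : ∀ μ ν, w μ ν ∈ Subgroup.center G)
    (hflat : ∀ (x : FinTorusSite (m₀ + 1) (m₁ + 1) (m₂ + 1) (m₃ + 1)) (μ ν : Fin 4), μ < ν →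
      tHooftTwistTensor w x μ ν * finTorusPlaquette U x μ ν = 1) :
    gaugeAct (axialGauge U) U = ladderConfig
      ![gaugeAct (axialGauge U) U (natSite m₀ m₁ m₂ m₃ 0 1 1 1, 0), gaugeAct (axialGauge U) U (natSite m₀ m₁ m₂ m₃ 1 0 1 1, 1),
        gaugeAct (axialGauge U) U (natSite m₀ m₁ m₂ m₃ 1 1 0 1, 2), gaugeAct (axialGauge U) U (natSite m₀ m₁ m₂ m₃ 1 1 1 0, 3)] := by
  funext e
  obtain ⟨x, μ⟩ := e
  rw [ladderConfig_apply]
  by_cases hx : finTorusSiteCoord x μ = 0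
  · rw [if_pos hx]
    obtain ⟨a, b, c, d⟩ := x
    have hsheet := gaugeAct_axialGauge_sheet hw hflat (one_le_finRep a) (finRep_le a) (one_le_finRep b) (finRep_le b)
      (one_le_finRep c) (finRep_le c) (one_le_finRep d) (finRep_le d)
    fin_cases μ
    · have ha : a = 0 := Fin.ext hx
      have hx' : ((a, b, c, d) : FinTorusSite (m₀ + 1) (m₁ + 1) (m₂ + 1) (m₃ + 1)) =
          natSite m₀ m₁ m₂ m₃ 0 (finRep b) (finRep c) (finRep d) := by
        rw [← natSite_finRep a b c d, ha]; simp [natSite, finRep]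
      simpa [hx'] using hsheet.1
    · have hb : b = 0 := Fin.ext hx
      have hx' : ((a, b, c, d) : FinTorusSite (m₀ + 1) (m₁ + 1) (m₂ + 1) (m₃ + 1)) =
          natSite m₀ m₁ m₂ m₃ (finRep a) 0 (finRep c) (finRep d) := by
        rw [← natSite_finRep a b c d, hb]; simp [natSite, finRep]
      simpa [hx'] using hsheet.2.1
    · have hc : c = 0 := Fin.ext hx
      have hx' : ((a, b, c, d) : FinTorusSite (m₀ + 1) (m₁ + 1) (m₂ + 1) (m₃ + 1)) =
          natSite m₀ m₁ m₂ m₃ (finRep a) (finRep b) 0 (finRep d) := by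
        rw [← natSite_finRep a b c d, hc]; simp [natSite, finRep]
      simpa [hx'] using hsheet.2.2.1
    · have hd : d = 0 := Fin.ext hx
      have hx' : ((a, b, c, d) : FinTorusSite (m₀ + 1) (m₁ + 1) (m₂ + 1) (m₃ + 1)) =
          natSite m₀ m₁ m₂ m₃ (finRep a) (finRep b) (finRep c) 0 := by
        rw [← natSite_finRep a b c d, hd]; simp [natSite, finRep]
      simpa [hx'] using hsheet.2.2.2
  · rw [if_neg hx]
    exact gaugeAct_axialGauge_of_coord_ne_zero hflat x hx

/-- ★★ **CLASSIFICATION OF THE CLASSICAL VACUA OF A TWISTED `Fin` BOX.**  For ANY group `G`, ANY box with all sides `≥ 1` and ANY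
centre-valued 't Hooft tensor `w`: a link configuration all of whose twisted plaquette holonomies are trivial (a zero-action configuration
of the twisted Wilson weight, for a faithful unitary `ρ`) is a GAUGE TRANSFORM OF A LADDER `ladderConfig Γ` whose quadruple EATS THE
TWIST, `w μ ν · Γ_μ Γ_ν Γ_μ⁻¹ Γ_ν⁻¹ = 1` (`μ < ν`).  (Lattice form of «flat connections with 't Hooft flux ↔ twist-eating transition
functions»; the anisotropic `Fin`-box counterpart of `isTwistedFlat_iff_exists_gaugeTransform_eaterConfig`.)  The gauge map is the inverse
of the sheet-adapted axial gauge `axialGauge U`. [folklore] -/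
theorem exists_gaugeAct_ladderConfig_of_twistedFlat (hw : ∀ μ ν, w μ ν ∈ Subgroup.center G)
    (U : FinTorusSite (m₀ + 1) (m₁ + 1) (m₂ + 1) (m₃ + 1) × Fin 4 → G)
    (hflat : ∀ (x : FinTorusSite (m₀ + 1) (m₁ + 1) (m₂ + 1) (m₃ + 1)) (μ ν : Fin 4), μ < ν →
      tHooftTwistTensor w x μ ν * finTorusPlaquette U x μ ν = 1) :
    ∃ (g : FinTorusSite (m₀ + 1) (m₁ + 1) (m₂ + 1) (m₃ + 1) → G) (Γ : Fin 4 → G),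
      (∀ μ ν : Fin 4, μ < ν → w μ ν * (Γ μ * Γ ν * (Γ μ)⁻¹ * (Γ ν)⁻¹) = 1) ∧ U = gaugeAct g (ladderConfig Γ) := by
  obtain ⟨Γ, hΓ⟩ : ∃ Γ : Fin 4 → G, gaugeAct (axialGauge U) U = ladderConfig Γ :=
    ⟨_, gaugeAct_axialGauge_eq_ladderConfig hw hflat⟩
  refine ⟨(axialGauge U)⁻¹, Γ, ?_, ?_⟩
  · refine (ladderConfig_twistedFlat_iff (m₀ := m₀) (m₁ := m₁) (m₂ := m₂) (m₃ := m₃) w Γ).mp ?_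
    rw [← hΓ]
    exact (twistedFlat_gaugeAct_iff hw _ U).mpr hflat
  · rw [← hΓ, gaugeAct_inv_gaugeAct]

/-- ★★ **Twisted-flat ⇔ gauge transform of a twist-eating ladder** (both directions; the converse is gauge invariance of twisted-flatness
and the plaquettes of a ladder). [folklore] -/
theorem twistedFlat_iff_exists_gaugeAct_ladderConfig (hw : ∀ μ ν, w μ ν ∈ Subgroup.center G)
    (U : FinTorusSite (m₀ + 1) (m₁ + 1) (m₂ + 1) (m₃ + 1) × Fin 4 → G) :
    (∀ (x : FinTorusSite (m₀ + 1) (m₁ + 1) (m₂ + 1) (m₃ + 1)) (μ ν : Fin 4), μ < ν →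
        tHooftTwistTensor w x μ ν * finTorusPlaquette U x μ ν = 1) ↔
      ∃ (g : FinTorusSite (m₀ + 1) (m₁ + 1) (m₂ + 1) (m₃ + 1) → G) (Γ : Fin 4 → G),
        (∀ μ ν : Fin 4, μ < ν → w μ ν * (Γ μ * Γ ν * (Γ μ)⁻¹ * (Γ ν)⁻¹) = 1) ∧ U = gaugeAct g (ladderConfig Γ) := by
  constructor
  · exact exists_gaugeAct_ladderConfig_of_twistedFlat hw U
  · rintro ⟨g, Γ, hΓ, rfl⟩
    exact (twistedFlat_gaugeAct_iff hw g _).mpr ((ladderConfig_twistedFlat_iff w Γ).mpr hΓ)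

/-- **A twist sector has a classical vacuum iff its tensor is eaten by some quadruple** (existence half = the ladder of an eater). [folklore] -/
theorem exists_twistedFlat_iff_exists_eater (hw : ∀ μ ν, w μ ν ∈ Subgroup.center G) :
    (∃ U : FinTorusSite (m₀ + 1) (m₁ + 1) (m₂ + 1) (m₃ + 1) × Fin 4 → G,
        ∀ (x : FinTorusSite (m₀ + 1) (m₁ + 1) (m₂ + 1) (m₃ + 1)) (μ ν : Fin 4), μ < ν →
          tHooftTwistTensor w x μ ν * finTorusPlaquette U x μ ν = 1) ↔
      ∃ Γ : Fin 4 → G, ∀ μ ν : Fin 4, μ < ν → w μ ν * (Γ μ * Γ ν * (Γ μ)⁻¹ * (Γ ν)⁻¹) = 1 := by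
  constructor
  · rintro ⟨U, hU⟩
    obtain ⟨-, Γ, hΓ, -⟩ := exists_gaugeAct_ladderConfig_of_twistedFlat hw U hU
    exact ⟨Γ, hΓ⟩
  · rintro ⟨Γ, hΓ⟩
    exact ⟨ladderConfig Γ, (ladderConfig_twistedFlat_iff w Γ).mpr hΓ⟩

end Classification

end Summit.QuantumFields.YangMills.Cruxes.IRcof.TwistedSlab
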